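import Summits.AtomisticToContinuum.FouriersLaw.Theorems.BondHeatUncertaintyBoundedResponseSurvivalSumRule
import HarnessLib

/-!
# `BondHeatUncertainty.BoundedResponse` (11071) — NODE g97 «TailSign» (lens-1 «grading», cell decomp-a2c)

**The sign ladder under door v7 graded by SCALE, the refutation of its bottom rung imported, and the door re-hung on
diffusive-window floors that the refuting witness cannot touch.**

Setting and names as in the landed g94–g96 modules (`…StorageLeak`, `…SurvivalSumRule`): pinned anharmonic chain, both
Langevin contacts at temperature `T`, Gibbs measure `μ_T`, semigroup `P_t`, `θ_b = p_b² − T`, near / far kernels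
`K_N(u) = ⟨θ₀, P_u θ₀⟩` (`escapeKernel`), `K̃_N(u) = ⟨θ₀, P_u θ_{N−1}⟩` (`crossKernel`), escape deficit (= end-to-end
transmission) `E_N = (γ/T²)∫_{(0,∞)} K̃_N` (`escapeDeficit`, `N ≥ 2`), finite-horizon transmission `X_N(t) = (γ/T²)∫_{(0,t]} K̃_N`,
return tail `R_N(t) = (γ/T²)∫_{(t,∞)} K_N`, two-exit survival `S_N(t) = (γ/T²)∫_{(t,∞)}(K_N + K̃_N)` (`survival`), storage kernel
`g_N(s) = Cov_T(p₀²(0), H_N(s))` (`storageKernel`), `Var_T(H_N) ≤ C_V·N` ((V), tree `energyFluctuationExtensive_holds`).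
The exact bookkeeping behind everything below is `E_N = X_N(t) + S_N(t) − R_N(t)` for every `t ≥ 0`
(`escapeDeficit_eq_transmission_add_survival_sub_returnTail`): a bound on `E_N` from a finite-horizon transmission bound needs a
FLOOR on the return tail `R_N` and a CEILING on the survival `S_N` at the same time `t` — nothing more.

## The fact of record this node imports (ledger, 2026-08-15/17)

Door v7 (`boundedResponse_of_leakPoint_boundaryDEP`, g96, admitted GEN 96S) hangs 11071 on the GLE sign crux 13198 `BoundaryDEP`
(`K_N(u) ≥ 0 ∧ K̃_N(u) ≥ 0` for every `u ≥ 0` and EVERY `N ≥ 1`).  The ledger notes of `stmt-AtomisticToContinuum-13198`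
(refuter-rattack-stmt-AtomisticToContinuum-13198-0, 2026-08-15T19:53Z; grounder g25-25 20:14Z; registrar
`Cruxes/BoundaryDEP/REGISTRAR.md`, 2026-08-17) record it **refuted-substantive numerically at `N = 1`**: for
`(ω₂, lam, β, γ, T) = (1, 2, 1, 1, 1)` (both baths on the single pinned quartic oscillator, friction `2γ`),
`K_1(2.5) = Cov_T(p²(0), p²(2.5)) = −4.66·10⁻³·T²` (Galerkin in `L²(Gibbs)`, truncations `(24,48)/(36,72)` agree to `5·10⁻⁹`;
independent `2·10⁷`-trajectory BAOAB Monte Carlo `z = −10.2`), and the TAIL form fails there too: `∫_{2.25}^∞ K_1 = −1.76·10⁻³`,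
`∫_{2.5}^∞ K_1 = −9.4·10⁻⁴`.  Mechanism: a complex slowest even (Kramers) mode makes `K_1` oscillate in sign at late times — a
FIXED-`N`, LATE-MICROSCOPIC-TIME phenomenon.  (The item is still `open` on the ledger: an SDE-kernel sign has no Lean `¬`; it is
wanted only by the dormant route GLE.)  At `N = 1` the near and far kernels coincide (`crossKernel_one`) and
`S_1 = 2·R_1` (`survival_one`), so that ONE witness refutes the `N = 1` instance of every fixed-`N` sign rung below at once.
Consequence for the cell: door v7's sign leg is dead AS TYPED; the lens-1 job is to GRADE the sign hypothesis until a rung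
survives the witness and still carries the door.

## The grading (lens-1): sign hypotheses by form (pointwise → tail → one covariance) and by SCALE (fixed `N` → diffusive window)

FIXED-`N` rungs (typed from `N = 2`, every `t ≥ 0`):
* `ReturnTailSign` (RT): `∫_{(t,∞)} K_N ≥ 0` — equivalently `θ_N(t) ≤ θ_N(∞) = 1 − E_N`, no overshoot of the near step response
  (`returnTail_nonneg_iff_stepResponse_le`);  `CrossTailSign` (CT): `∫_{(t,∞)} K̃_N ≥ 0` — equivalently `X_N(t) ≤ E_N`
  (`crossTail_nonneg_iff_transmission_le`);  `TailDEP := RT ∧ CT` ⟸ 13198 (`tailDEP_of_boundaryDEP`).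
* `SurvivalSign` (SS): `S_N(t) ≥ 0` ⟸ `TailDEP` (`survivalSign_of_tailDEP`) and ⟸ `CoolingSign` (CS): `g_N(s) ≥ 0`
  (`survivalSign_of_coolingSign`: `∫ₜ^{t'} S_N = T⁻²∫ₜ^{t'} g_N` and `S_N` is continuous) — the sign of ONE covariance.
  Tags: WEAKER than 13198 · UNDECIDED for `N ≥ 2` (no witness on the ledger; the refuter's dimer job was never reported) but
  THREATENED by the `N = 1` mechanism at late microscopic times near the contact · phonon-TRUE (Isserlis squares) · INSTRUMENTABLE
  (`N ∈ {2,3}`: Galerkin/MC as in the refuter's evidence files `galerkin_rk4.py`, `mc_n1.c`).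
DIFFUSIVE-WINDOW floors (eventually in `N`, on `t ∈ [A·N², 2A·N²]`, tolerance `O(1/N)`):
* `ReturnTailFloor` (RT∞): `∀ A > 0 ∃ C ∀ᶠ N ∀ t ∈ [A·N², 2A·N²], N·R_N(t) ≥ −C`;  `CrossTailFloor` (CT∞): the same for
  `(γ/T²)∫_{(t,∞)} K̃_N`;  `WindowSurvivalPoint` (WSP): `∀ A > 0 ∃ C ∀ᶠ N ∃ t ∈ [A·N², 2A·N²], N·S_N(t) ≤ C`.
  `RT → RT∞`, `CT → CT∞` (constant `0`), `SS → WSP` (`windowSurvivalPoint_of_survivalSign`, by the WINDOW LEMMA: under `S_N ≥ 0`,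
  `S^{stor}_N = ∫₀ S_N` is non-decreasing to `Var_T(H_N)/(2γT²)`, so `min_{[a,2a]} S_N ≤ Var_T(H_N)/(2γT²a)`; with (V) and `a = A·N²`
  this is `≤ |C_V|/(2γT²A·N)`).
  Tags: WEAKER than every fixed-`N` rung · UNDECIDED · TRUE-leaning · UNTOUCHED BY THE `N = 1` WITNESS BY CONSTRUCTION (eventually in
  `N`; diffusive times, where fixed-`N` late-time oscillations are exponentially small; `O(1/N)` slack) · phonon-TRUE · INSTRUMENTABLE
  (equilibrium MD, `N ∈ {4,…,32}`: `N·R_N`, `N·(γ/T²)∫_t^∞K̃_N`, `N·S_N` on `[N², 2N²]`).  RT∞/CT∞ are the WINDOW/`O(1)`-tolerance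
  analogue of the registrar's proposed repair `BoundaryTailSignAsymptotic` (ONE time `A·N²` per horizon, tolerance `o(1)`); as typed
  neither implies the other (BTSA is pointwise in the horizon and not uniform over a window; the floors tolerate `O(1)`, not `o(1)`).

## Theorems (0 sorry)

1. **DOOR v9** `boundedResponse_of_transmissionWindowBound_floors :
   TransmissionWindowBound → ReturnTailFloor → WindowSurvivalPoint → BoundedResponse`, where (TW) `TransmissionWindowBound` :=
   `∃ A > 0, C: ∀ᶠ N ∀ t ∈ [A·N², 2A·N²], N·X_N(t) ≤ C` (window form of g96's reading `FiniteHorizonBound`).  Proof: at the WSP time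
   `t`, `N·E_N = N·X_N(t) + N·S_N(t) − N·R_N(t) ≤ C₀ + C_S + C_R`.  Converse `transmissionWindowBound_of_boundedResponse_crossTailFloor :
   BoundedResponse → CrossTailFloor → TransmissionWindowBound` (`X_N(t) = E_N − (γ/T²)∫_{(t,∞)}K̃_N ≤ (C₁ + C)/N`).  Hence
   **`TransmissionWindowBound ↔ BoundedResponse` modulo {RT∞, CT∞, WSP}** (`transmissionWindowBound_iff_boundedResponse_of_floors`),
   and a fortiori modulo the fixed-`N` rungs (`…_returnTail_survivalSign`, `…_of_tailDEP`) and modulo 13198.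
2. **Survival profile, sign-free** (`N ≥ 2`): `S_N` continuous on `[0,b]`, `S_N(0) = 1`, `S_N(t) → 0`, `∫ₜ^{t'} S_N = T⁻²∫ₜ^{t'} g_N`;
   under `S_N ≥ 0` at fixed `N`: `S^{stor}_N(t) ≤ Var_T(H_N)/(2γT²)` (`storageResponse_le_variance_of_survival_nonneg`), the window lemma
   (`exists_window_survival_le`, `exists_window_survival_small`).
3. **Fixed-`N` legs and door v7 on its true hypotheses**: `SurvivalSign → StorageBound` (D_S), `CrossTailSign → SurvivalSign →
   TransientCeilingPoint` (U), `ReturnTailSign → TransientFloor g` (F_g; the transient integrand IS the return tail,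
   `oneSub_stepResponse_sub_escapeDeficit_eq_returnTail`), hence `LeakPoint → ReturnTailSign → SurvivalSign → BoundedResponse`
   (door v7 with 13198 replaced by the two `N ≥ 2` tail rungs it consumes) and `LeakPoint ↔ TransmissionWindowBound ↔
   DeficitCesaroPoint ↔ BoundedResponse` modulo `TailDEP`.
4. **`N = 1` coincidence**: `crossKernel_one`, `survival_one` (why one witness kills every fixed-`N` rung at `N = 1`).

## Tags (doctrine currency) and the honest score

* Residual of record UNCHANGED: (D_F) `LeakPoint` / its window form (TW) — EQUIV to 11071 modulo {RT∞, CT∞, WSP} (COSTUME as a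
  stand-alone split; it is the ATTACK STATEMENT) · phonon-FALSE · IDEA-NEEDED (post-arrival decay of `K̃_N`; g96 I1).
* The «mod» set of (D_F) changes from {13198} (numerically REFUTED) to {`ReturnTailFloor`, `WindowSurvivalPoint`} (door) and
  {`CrossTailFloor`} (converse): UNDECIDED · TRUE-leaning · robust · INSTRUMENTABLE — the weakest sign-type side hypotheses any
  survival-budget door can use (item 0 of the bookkeeping above), and the first rung of the ladder not reached by the witness.
* Where theorems stop: NOTHING on the ladder is proved for `lam, β > 0` at any `N`; at `lam = β = 0` every rung holds (squares);
  the `N = 1` anharmonic bottom is numerically FALSE (above).  No claim is made about `γ → 0` or weak anharmonicity beyond the memo.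

Why novel (by construction): lens-1 is the only lineage on N_F; the tree's one tail-sign hypothesis is the inline `∀ N ≥ 1` return
tail of `transientFloor_of_kernelTail_nonneg` (g93) — refuted at `N = 1` by the same witness; no tree declaration states a cross-tail,
survival or cooling sign, nor any sign hypothesis at the diffusive scale with `O(1/N)` tolerance (`rg 'TailFloor|WindowSurvival|
SurvivalSign|CoolingSign|TailDEP'` over `Summits/AtomisticToContinuum` = 0 hits before this node), and no door of record survives the
13198 refutation except through the UNDECIDED pieces (D_S), (F₁) of door v6 — which this node's floors undercut on the (D_F)/(TW) axis.

Tags per declaration: `[new]` = stated and proved here first; `[folklore]` = bookkeeping.  0 sorry, no new axioms.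
-/

noncomputable section

open MeasureTheory ProbabilityTheory Filter Topology Set Function
open scoped NNReal ENNReal
open Literature.MathematicalPhysics.KineticTheory.HeatConduction
open Literature.MathematicalPhysics.KineticTheory OscillatorChain
open Summit.AtomisticToContinuum.FouriersLaw.Theorems.SubdiffusiveBondHeat
open Summit.AtomisticToContinuum.FouriersLaw.Theorems.OddSectorIrreversibility
open Summit.AtomisticToContinuum.FouriersLaw.Theorems.BoundedResponse.TransientBand

namespace Summit.AtomisticToContinuum.FouriersLaw.Theorems.BoundedResponse.ParityFloor

open Summit.AtomisticToContinuum.FouriersLaw.Theses.BondHeatUncertainty (BoundedResponse)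
open Summit.AtomisticToContinuum.FouriersLaw.Theses.GriffithsLimitExchange (BoundaryDEP FiniteHorizonTransmission)
open Summit.AtomisticToContinuum.FouriersLaw.Theorems.SubdiffusiveBondHeat.EscapeGrading
  (escapeDeficit OhmicFloor ohmicFloor_iff_boundedResponse)

section TailSign

variable {ω₂ lam β γ T : ℝ} {N : ℕ}

/-! ## §1 The graded sign hypotheses (fixed-`N` rungs from `N = 2`; diffusive-window floors) and the window leak piece -/

/-- **(RT) `ReturnTailSign`** — fixed-`N` tail form of the near-kernel sign: `∫_{(t,∞)} K_N(u) du ≥ 0` for every `t ≥ 0` and every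
`N ≥ 2` (`= ⟨θ₀, P_t h₀⟩_{μ_T}`; equivalently `θ_N(t) ≤ 1 − E_N`).  Typed from `N = 2`: its `N = 1` instance is numerically REFUTED
(ledger notes of stmt-…-13198, 2026-08-15: `∫_{2.5}^∞ K_1 = −9.4·10⁻⁴ < 0` at `(ω₂,lam,β,γ,T) = (1,2,1,1,1)`).  Tags: WEAKER than 13198 ·
UNDECIDED (`N ≥ 2`) · THREATENED by the `N = 1` mechanism · phonon-TRUE · INSTRUMENTABLE. (piece · side hypothesis)
[route statement · this cell; NOT a literature fact] [new] -/
def ReturnTailSign : Prop :=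
  ∀ ω₂ lam β γ : ℝ, 0 < ω₂ → 0 < lam → 0 < β → 0 < γ → ∀ T : ℝ, 0 < T →
    ∀ (N : ℕ) (t : ℝ), 2 ≤ N → 0 ≤ t → 0 ≤ ∫ u in Ioi t, escapeKernel ω₂ lam β γ T N u

/-- **(CT) `CrossTailSign`** — fixed-`N` tail form of the far-kernel sign: `∫_{(t,∞)} K̃_N(u) du ≥ 0` for every `t ≥ 0`, `N ≥ 2`
(equivalently `X_N(t) ≤ E_N`: the transmission collected by time `t` never exceeds the total).  At `N = 1` it coincides with (RT)
(`crossKernel_one`) and is refuted there with it.  Tags as (RT). (piece · side hypothesis) [route statement · this cell] [new] -/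
def CrossTailSign : Prop :=
  ∀ ω₂ lam β γ : ℝ, 0 < ω₂ → 0 < lam → 0 < β → 0 < γ → ∀ T : ℝ, 0 < T →
    ∀ (N : ℕ) (t : ℝ), 2 ≤ N → 0 ≤ t → 0 ≤ ∫ u in Ioi t, crossKernel ω₂ lam β γ T N u

/-- **`TailDEP`** — the `N ≥ 2` TAIL form of the GLE sign crux 13198 `BoundaryDEP` (`tailDEP_of_boundaryDEP`).  Tags: WEAKER than
13198 · UNDECIDED · THREATENED · INSTRUMENTABLE. (piece · side hypothesis) [new] -/
def TailDEP : Prop := ReturnTailSign ∧ CrossTailSign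

/-- **(SS) `SurvivalSign`** — the two-exit survival function is non-negative: `S_N(t) ≥ 0` for `t ≥ 0`, `N ≥ 2`
(`S_N(t) = Cov_T(p₀²(0), H_N(t))/T²`, the fraction of a contact energy injection still stored at time `t`).  Implied by `TailDEP`
(`survivalSign_of_tailDEP`) and by `CoolingSign` (`survivalSign_of_coolingSign`); at `N = 1`, `S_1 = 2·R_1` (`survival_one`) is
refuted with (RT).  Tags: WEAKEST fixed-`N` rung · UNDECIDED · THREATENED · phonon-TRUE · INSTRUMENTABLE (one covariance).
(piece · side hypothesis) [new] -/
def SurvivalSign : Prop :=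
  ∀ ω₂ lam β γ : ℝ, 0 < ω₂ → 0 < lam → 0 < β → 0 < γ → ∀ T : ℝ, 0 < T →
    ∀ (N : ℕ) (t : ℝ), 2 ≤ N → 0 ≤ t → 0 ≤ survival ω₂ lam β γ T N t

/-- **(CS) `CoolingSign`** — the storage / cooling covariance is non-negative: `g_N(s) = Cov_T(p₀²(0), H_N(s)) ≥ 0` for `s ≥ 0`,
`N ≥ 2` (detailed-balance reading: after a uniform quench from `T' > T` to baths at `T`, the contact kinetic temperature never
undershoots `T`, to first order).  At `N = 1`, `g_1 = T²·S_1 = 2T²·R_1` is refuted with (RT).  Tags: UNDECIDED · THREATENED ·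
phonon-TRUE · INSTRUMENTABLE (quench or equilibrium MD). (piece · side hypothesis) [new] -/
def CoolingSign : Prop :=
  ∀ ω₂ lam β γ : ℝ, 0 < ω₂ → 0 < lam → 0 < β → 0 < γ → ∀ T : ℝ, 0 < T →
    ∀ (N : ℕ) (s : ℝ), 2 ≤ N → 0 ≤ s → 0 ≤ storageKernel ω₂ lam β γ T N s

/-- **(RT∞) `ReturnTailFloor`** — the DIFFUSIVE-WINDOW floor of the return tail: for every `A > 0` there is `C` with
`N·(γ/T²)∫_{(t,∞)} K_N ≥ −C` for all `t ∈ [A·N², 2A·N²]` and all large `N` (the returned-energy response overshoots its final value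
by at most `O(1/N)` at diffusive times).  Implied by (RT) with `C = 0`; untouched by fixed-`N` late-time sign oscillations.  Tags: WEAKER
than (RT) · UNDECIDED · TRUE-leaning · phonon-TRUE · INSTRUMENTABLE. (piece · side hypothesis) [route statement · this cell] [new] -/
def ReturnTailFloor : Prop :=
  ∀ ω₂ lam β γ : ℝ, 0 < ω₂ → 0 < lam → 0 < β → 0 < γ → ∀ T : ℝ, 0 < T →
    ∀ A : ℝ, 0 < A → ∃ C : ℝ, ∀ᶠ N : ℕ in atTop, ∀ t ∈ Icc (A * (N : ℝ) ^ 2) (2 * (A * (N : ℝ) ^ 2)),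
      -C ≤ (N : ℝ) * (γ / T ^ 2 * ∫ u in Ioi t, escapeKernel ω₂ lam β γ T N u)

/-- **(CT∞) `CrossTailFloor`** — the diffusive-window floor of the cross tail: `N·(γ/T²)∫_{(t,∞)} K̃_N ≥ −C` on `[A·N², 2A·N²]`
for all large `N` (the transmission collected by a diffusive time exceeds the total by at most `O(1/N)`).  Implied by (CT).  Tags as
(RT∞). (piece · side hypothesis of the CONVERSE door) [route statement · this cell] [new] -/
def CrossTailFloor : Prop :=
  ∀ ω₂ lam β γ : ℝ, 0 < ω₂ → 0 < lam → 0 < β → 0 < γ → ∀ T : ℝ, 0 < T →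
    ∀ A : ℝ, 0 < A → ∃ C : ℝ, ∀ᶠ N : ℕ in atTop, ∀ t ∈ Icc (A * (N : ℝ) ^ 2) (2 * (A * (N : ℝ) ^ 2)),
      -C ≤ (N : ℝ) * (γ / T ^ 2 * ∫ u in Ioi t, crossKernel ω₂ lam β γ T N u)

/-- **(WSP) `WindowSurvivalPoint`** — in every diffusive window the stored fraction is somewhere `O(1/N)`: for every `A > 0` there is
`C` with `∃ t ∈ [A·N², 2A·N²], N·S_N(t) ≤ C` for all large `N`.  Implied by (SS) (window lemma + (V), `windowSurvivalPoint_of_survivalSign`)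
and, at its own horizon, by GLE's 13200 `VanishingSurvival`; no sign of `S_N` is asserted.  Tags: WEAKER than (SS) · UNDECIDED ·
TRUE-leaning (diffusive exit of a contact injection) · phonon-TRUE (ballistic exit) · INSTRUMENTABLE. (piece · side hypothesis)
[route statement · this cell] [new] -/
def WindowSurvivalPoint : Prop :=
  ∀ ω₂ lam β γ : ℝ, 0 < ω₂ → 0 < lam → 0 < β → 0 < γ → ∀ T : ℝ, 0 < T →
    ∀ A : ℝ, 0 < A → ∃ C : ℝ, ∀ᶠ N : ℕ in atTop, ∃ t ∈ Icc (A * (N : ℝ) ^ 2) (2 * (A * (N : ℝ) ^ 2)),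
      (N : ℝ) * survival ω₂ lam β γ T N t ≤ C

/-- **(TW) `TransmissionWindowBound`** — the WINDOW form of the finite-horizon transmission bound: for some horizon constant
`A > 0`, `N·X_N(t) ≤ C` for all `t` in the diffusive window `[A·N², 2A·N²]` and all large `N`
(`X_N(t) = (γ/T²)∫_{(0,t]} K̃_N`).  It implies g96's point reading `FiniteHorizonBound` and is EQUIVALENT to 11071 modulo the floors
{RT∞, CT∞, WSP} (`transmissionWindowBound_iff_boundedResponse_of_floors`).  Tags: EQUIV-mod-floors · phonon-FALSE · IDEA-NEEDED — the
attack statement of the residual (D_F), not a weaker piece. (piece · reading) [route statement · this cell] [new] -/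
def TransmissionWindowBound : Prop :=
  ∀ ω₂ lam β γ : ℝ, 0 < ω₂ → 0 < lam → 0 < β → 0 < γ → ∀ T : ℝ, 0 < T →
    ∃ A C : ℝ, 0 < A ∧ ∀ᶠ N : ℕ in atTop, ∀ t ∈ Icc (A * (N : ℝ) ^ 2) (2 * (A * (N : ℝ) ^ 2)),
      (N : ℝ) * (γ / T ^ 2 * ∫ u in Ioc 0 t, crossKernel ω₂ lam β γ T N u) ≤ C

/-! ## §2 The ladder: 13198 ⟹ TailDEP ⟹ SurvivalSign; fixed-`N` rungs ⟹ window floors; the `N = 1` coincidence -/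

/-- `BoundaryDEP → TailDEP` (pointwise signs integrate to tail signs). [formal bookkeeping] -/
theorem tailDEP_of_boundaryDEP : BoundaryDEP → TailDEP := fun hDEP =>
  ⟨fun _ _ _ _ hω hl hβ hγ _ hT N _ _ ht =>
      setIntegral_nonneg measurableSet_Ioi fun u hu =>
        (kernels_nonneg_of_boundaryDEP hDEP hω hl hβ hγ hT N).1 u (ht.trans (le_of_lt hu)),
    fun _ _ _ _ hω hl hβ hγ _ hT N _ _ ht =>
      setIntegral_nonneg measurableSet_Ioi fun u hu =>
        (kernels_nonneg_of_boundaryDEP hDEP hω hl hβ hγ hT N).2 u (ht.trans (le_of_lt hu))⟩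

/-- `S_N(t) = (γ/T²)(∫_{(t,∞)} K_N + ∫_{(t,∞)} K̃_N)` for `t ≥ 0` (both kernels are in `L¹(0,∞)`). [folklore] -/
theorem survival_eq_tails (hω : 0 < ω₂) (hl : 0 < lam) (hβ : 0 < β) (hγ : 0 < γ) (hT : 0 < T) (N : ℕ)
    {t : ℝ} (ht : 0 ≤ t) :
    survival ω₂ lam β γ T N t =
      γ / T ^ 2 * ((∫ u in Ioi t, escapeKernel ω₂ lam β γ T N u) + ∫ u in Ioi t, crossKernel ω₂ lam β γ T N u) := by
  rw [survival, integral_add ((integrableOn_escapeKernel hω hl hβ hγ hT N).mono_set (Ioi_subset_Ioi ht))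
    ((integrableOn_crossKernel hω hl hβ hγ hT N).mono_set (Ioi_subset_Ioi ht))]

/-- `TailDEP → SurvivalSign`. [formal bookkeeping] -/
theorem survivalSign_of_tailDEP : TailDEP → SurvivalSign := by
  rintro ⟨hR, hX⟩ ω₂ lam β γ hω hl hβ hγ T hT N t hN ht
  rw [survival_eq_tails hω hl hβ hγ hT N ht]
  exact mul_nonneg (by positivity) (add_nonneg (hR ω₂ lam β γ hω hl hβ hγ T hT N t hN ht)
    (hX ω₂ lam β γ hω hl hβ hγ T hT N t hN ht))

/-- `ReturnTailSign → ReturnTailFloor` (constant `0`, every window). [formal bookkeeping] -/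
theorem returnTailFloor_of_returnTailSign : ReturnTailSign → ReturnTailFloor := by
  intro hR ω₂ lam β γ hω hl hβ hγ T hT A hA
  refine ⟨0, ?_⟩
  filter_upwards [eventually_ge_atTop 2] with N hN t ht
  have ht0 : 0 ≤ t := le_trans (by positivity) ht.1
  rw [neg_zero]
  exact mul_nonneg (Nat.cast_nonneg N) (mul_nonneg (by positivity) (hR ω₂ lam β γ hω hl hβ hγ T hT N t hN ht0))

/-- `CrossTailSign → CrossTailFloor` (constant `0`, every window). [formal bookkeeping] -/
theorem crossTailFloor_of_crossTailSign : CrossTailSign → CrossTailFloor := by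
  intro hX ω₂ lam β γ hω hl hβ hγ T hT A hA
  refine ⟨0, ?_⟩
  filter_upwards [eventually_ge_atTop 2] with N hN t ht
  have ht0 : 0 ≤ t := le_trans (by positivity) ht.1
  rw [neg_zero]
  exact mul_nonneg (Nat.cast_nonneg N) (mul_nonneg (by positivity) (hX ω₂ lam β γ hω hl hβ hγ T hT N t hN ht0))

/-- **At `N = 1` the far kernel IS the near kernel** (both baths act on the one oscillator): `K̃_1 = K_1`. [folklore] -/
theorem crossKernel_one (u : ℝ) : crossKernel ω₂ lam β γ T 1 u = escapeKernel ω₂ lam β γ T 1 u := by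
  rw [crossKernel_of_pos one_pos, escapeKernel_eq_kinAct one_pos]
  rfl

/-- **At `N = 1` the survival is twice the return tail**: `S_1(t) = 2·(γ/T²)∫_{(t,∞)} K_1` — so the ledger's `N = 1` witness
`∫_{2.5}^∞ K_1 < 0` refutes the `N = 1` instances of (RT), (CT), (SS) (and (CS), `g_1 = T²S_1`) simultaneously; this is why the
fixed-`N` rungs are typed from `N = 2`. [folklore] -/
theorem survival_one (t : ℝ) :
    survival ω₂ lam β γ T 1 t = 2 * (γ / T ^ 2 * ∫ u in Ioi t, escapeKernel ω₂ lam β γ T 1 u) := by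
  simp only [survival, crossKernel_one, ← two_mul, integral_const_mul]
  ring

end TailSign

end Summit.AtomisticToContinuum.FouriersLaw.Theorems.BoundedResponse.ParityFloor

end
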